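import Mathlib
import Summits.Parity.BatemanHorn.Theorems.IsogenyRedeiSplitBlockJacobiPureDigitPiecesPV
import Summits.Parity.BatemanHorn.Theorems.IsogenyRedeiSplitBlockJacobiPureDigitPiecesPowPV
import Summits.Parity.BatemanHorn.Theorems.IsogenyRedeiSplitBlockJacobiPureDigitPiecesBurgessAux
import Literature.NumberTheory.LFunctions.RobertSargosFirstSpacing
import HarnessLib

/-!
# Route `IsogenyRedei`, crux `SplitBlockJacobi` (stmt-Parity-11583), line `split-mass-middle-prime`:
# the pure digit pieces in the Burgess range, conditionally on Burgess's bound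
# (partial result towards `stub_pureDigitPiecesPow`)

The registered stub `stub_pureDigitPiecesPow` of the line skeleton asks, for `1/2 < θ < θ′ < 1`,
`0 < η`, `θ′ + η < 1`, for a **power saving** `O(x^{1-δ})`, `δ > 0`, in the `ℓ¹`-sum over
`(Q, ν, k, a)` — primes `x^θ < Q ≤ x^{θ′}`, roots `ν² ≡ −1 (mod Q)`, moduli `1 ≤ k ≤ x^η`, root
classes `a mod k` — of the absolute values of the digit-character sums
`Σ_{u : ν + Q(a+ku) ≤ x} ((ν²+1)/Q + 2ν(a+ku) | Q)`.  The tree has it in the Pólya–Vinogradov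
range `θ′/2 < 1 − θ′ − η` (`pureDigitPiecesPow_of_polyaVinogradov_range`).

This file proves it in the **Burgess range** `θ′/4 < 1 − θ′ − η`, *conditionally* on Burgess's
bound for the Legendre symbol (Iwaniec–Kowalski Thm 12.6, Burgess 1963 — in print, not in the
tree), which enters as an explicit hypothesis: for every integer `r ≥ 1` a constant `c > 0` with
`|Σ_{M<n≤M+N} (n | p)| ≤ c N^{1−1/r} p^{(r+1)/(4r²)} (1 + log p)` for all odd primes `p` and all
`M, N` (at `r = 1` this is Pólya–Vinogradov; the printed `(log p)^{1/r}` is relaxed to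
`1 + log p`).  The result is `pureDigitPiecesPow_of_burgess_range`, a `--supports` helper; it
does NOT close the stub ("Type-I_χ reaches exactly the Burgess range"; beyond it the stub is open).

## Proof

* Each inner sum runs over `u < H`, `H ≤ x/(Qk) + 1`, with summand `(α + βu | Q)`, `β = 2νk`,
  `Q ∤ β`; it reduces to a sum of `(· | Q)` over `H` consecutive integers
  (`abs_inner_le_of_intervalBound` of the Aux file), so Burgess with parameter `r` bounds it by
  `c H^s Q^b (1 + log Q)`, `s = 1 − 1/r`, `b = (r+1)/(4r²)`, and
  `H^s ≤ (x/(Qk))^s + 1` (subadditivity).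
* Bookkeeping keeping the `Q`- and `k`-dependence (`burgess_sum_le_majorant`): the part
  `c (1 + log x) x^s Q^{b−s} k^{−s}` sums to `≤ 4cC (1 + log x)³ x^{E₂}`,
  `E₂ = s + θ′(1 + b − s) + η(1 − s) = 1 − (1 − θ′ − η)/r + θ′ b`, via
  `Σ_Q Q^{b−s} ≤ x^{θ′(1+b−s)} Σ_{n≤x} 1/n` and `Σ_k ρ(k) k^{−s} ≤ x^{η(1−s)} Σ_{k≤x} ρ(k)/k`
  (harmonic bound `RobertSargos.sum_inv_Icc_le_log`, partial summation from `Σ_{k≤n} ρ(k) ≤ Cn`);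
  the part `c (1 + log x) x^{θ′b}`
  sums to `≤ 4cC (1 + log x) x^{E₁}`, `E₁ = θ′ + η + θ′ b`, by the tree's bookkeeping.
* Choice of `r`: `θ′(r+1)/(4r) < 1 − θ′ − η` for `r > θ′/(4ε₀)`, `ε₀ = 1 − θ′ − η − θ′/4 > 0`;
  then `E₁, E₂ < 1`, and with `E = max(E₁, E₂)`, `δ = (1 − E)/2`, the three logarithms are absorbed
  (`rpow_mul_one_add_log_pow_three_isBigO`): total `= O(x^{E + δ}) = O(x^{1−δ})`.

No new definitions; everything is proved (no named facts; Burgess is a hypothesis, not a fact).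
-/

noncomputable section

open Filter Finset Asymptotics
open scoped Classical

open Literature.NumberTheory.Sieve.Iwaniec1978 (rho rho_le_two exists_sum_rho_le)

namespace Summit.Parity.BatemanHorn.Cruxes.SplitBlockJacobi.SplitMassMiddlePrime

/-! ### The explicit majorant under a Burgess-type bound -/

/-- **The explicit majorant of the pure digit pieces under a Burgess-type bound.** Let
`0 < η ≤ θ`, `0 < θ′`, `C ≥ 0` with `Σ_{m ≤ n} ρ(m) ≤ C n` (`n ≥ 1`), and suppose every sum of
`(· | p)` (`p` an odd prime) over `N` consecutive integers has modulus `≤ c N^s p^b (1 + log p)`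
(`c, b ≥ 0`, `0 ≤ s ≤ 1`).  Then eventually in `x : ℕ` the `ℓ¹`-sum over `(Q, ν, k, a)` of the
absolute digit-character sums is `≤ 8cC · x^E · (1 + log x)³` for every
`E ≥ max(θ′ + η + θ′b, s + θ′(1 + b − s) + η(1 − s))`: each inner sum is
`≤ c (x/(Qk) + 1)^s Q^b (1 + log Q) ≤ c (1 + log x) (x^s Q^{b−s} k^{−s} + x^{θ′ b})`
(`abs_inner_le_of_intervalBound`, subadditivity `Real.rpow_add_le_add_rpow`), the `Q^{b−s}` are
summed by
`Q^{b−s} ≤ x^{θ′(1+b−s)}/Q` and the harmonic bound, the `ρ(k) k^{−s}` by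
`k^{−s} ≤ x^{η(1−s)}/k` and `Σ_{k ≤ x} ρ(k)/k ≤ C (1 + log x)` (partial summation), and the
constant part by the tree's bookkeeping (`≤ 2x^{θ′} · 2 · C x^η` weighted index triples).
[folklore] -/
theorem burgess_sum_le_majorant {θ θ' η C c s b E : ℝ} (hθ0 : 0 < θ) (hθ'0 : 0 < θ')
    (hη : 0 < η) (hηθ : η ≤ θ) (hC0 : 0 ≤ C)
    (hC : ∀ n : ℕ, 1 ≤ n → ∑ m ∈ Finset.Icc 1 n, (rho m : ℝ) ≤ C * n)
    (hc : 0 ≤ c) (hs0 : 0 ≤ s) (hs1 : s ≤ 1) (hb : 0 ≤ b)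
    (hE₁ : θ' + η + θ' * b ≤ E) (hE₂ : s + θ' * (1 + b - s) + η * (1 - s) ≤ E)
    (hB : ∀ p : ℕ, p.Prime → p ≠ 2 → ∀ M N : ℕ,
      |∑ n ∈ Finset.Ioc M (M + N), (jacobiSym (n : ℤ) p : ℝ)| ≤
        c * (N : ℝ) ^ s * (p : ℝ) ^ b * (1 + Real.log p)) :
    ∀ᶠ x : ℕ in atTop,
      ∑ Q ∈ (Finset.range (x + 1)).filter
          (fun Q : ℕ => Q.Prime ∧ (x : ℝ) ^ θ < (Q : ℝ) ∧ (Q : ℝ) ≤ (x : ℝ) ^ θ'),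
        ∑ ν ∈ (Finset.range Q).filter (fun ν : ℕ => Q ∣ ν ^ 2 + 1),
          ∑ k ∈ (Finset.Icc 1 x).filter (fun k : ℕ => (k : ℝ) ≤ (x : ℝ) ^ η),
            ∑ a ∈ (Finset.range k).filter (fun a : ℕ => Q * k ∣ (ν + Q * a) ^ 2 + 1),
              |∑ u ∈ (Finset.range (x + 1)).filter (fun u : ℕ => ν + Q * (a + k * u) ≤ x),
                  (jacobiSym (((ν ^ 2 + 1) / Q + 2 * ν * (a + k * u) : ℕ) : ℤ) Q : ℝ)| ≤
        8 * c * C * ((x : ℝ) ^ E * (1 + Real.log x) ^ 3) := by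
  have hev_θ : ∀ᶠ x : ℕ in atTop, (2 : ℝ) ≤ (x : ℝ) ^ θ :=
    ((tendsto_rpow_atTop hθ0).comp tendsto_natCast_atTop_atTop).eventually_ge_atTop 2
  filter_upwards [eventually_ge_atTop 1, hev_θ] with x hx1 hxθ
  have hx0 : (0 : ℝ) < x := by exact_mod_cast hx1
  have hx1' : (1 : ℝ) ≤ x := by exact_mod_cast hx1
  have hxηθ : (x : ℝ) ^ η ≤ (x : ℝ) ^ θ := Real.rpow_le_rpow_of_exponent_le hx1' hηθ
  set L : ℝ := 1 + Real.log x with hL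
  have hL1 : 1 ≤ L := by have := Real.log_nonneg hx1'; rw [hL]; linarith
  have hL0 : 0 < L := by linarith
  set SQ := (Finset.range (x + 1)).filter
    (fun Q : ℕ => Q.Prime ∧ (x : ℝ) ^ θ < (Q : ℝ) ∧ (Q : ℝ) ≤ (x : ℝ) ^ θ') with hSQ
  set Sk := (Finset.Icc 1 x).filter (fun k : ℕ => (k : ℝ) ≤ (x : ℝ) ^ η) with hSk
  set G : ℕ → ℝ := fun Q => c * L * (x : ℝ) ^ s * (Q : ℝ) ^ (b - s) with hG
  set h : ℕ → ℝ := fun k => (k : ℝ) ^ (-s) with hh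
  set B : ℝ := c * L * (x : ℝ) ^ (θ' * b) with hBdef
  have hB0 : 0 ≤ B := by positivity
  -- the two one-dimensional sums
  have hGsum : ∑ Q ∈ SQ, G Q ≤ c * L * (x : ℝ) ^ s * ((x : ℝ) ^ (θ' * (1 + b - s)) * L) := by
    simp only [hG]
    rw [← Finset.mul_sum]
    refine mul_le_mul_of_nonneg_left ?_ (by positivity)
    calc ∑ Q ∈ SQ, (Q : ℝ) ^ (b - s)
        ≤ ∑ Q ∈ SQ, (x : ℝ) ^ (θ' * (1 + b - s)) * (1 / (Q : ℝ)) := by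
          refine Finset.sum_le_sum fun Q hQ => ?_
          simp only [hSQ, Finset.mem_filter, Finset.mem_range] at hQ
          obtain ⟨_, hQp, _, hQθ'⟩ := hQ
          have hQpos : (0 : ℝ) < Q := by exact_mod_cast hQp.pos
          rw [show b - s = (1 + b - s) - 1 by ring, Real.rpow_sub_one hQpos.ne',
            ← div_eq_mul_one_div]
          gcongr
          rw [Real.rpow_mul hx0.le]
          exact Real.rpow_le_rpow hQpos.le hQθ' (by linarith)
      _ = (x : ℝ) ^ (θ' * (1 + b - s)) * ∑ Q ∈ SQ, 1 / (Q : ℝ) := by rw [Finset.mul_sum]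
      _ ≤ (x : ℝ) ^ (θ' * (1 + b - s)) * L := by
          refine mul_le_mul_of_nonneg_left ?_ (by positivity)
          calc ∑ Q ∈ SQ, 1 / (Q : ℝ) ≤ ∑ n ∈ Finset.Icc 1 x, 1 / (n : ℝ) := by
                refine Finset.sum_le_sum_of_subset_of_nonneg (fun Q hQ => ?_)
                  fun _ _ _ => by positivity
                simp only [hSQ, Finset.mem_filter, Finset.mem_range, Finset.mem_Icc] at hQ ⊢
                exact ⟨hQ.2.1.one_lt.le, Nat.lt_succ_iff.1 hQ.1⟩
            _ ≤ L := Literature.NumberTheory.LFunctions.RobertSargos.sum_inv_Icc_le_log hx1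
  have hhsum : ∑ k ∈ Sk, (rho k : ℝ) * h k ≤ (x : ℝ) ^ (η * (1 - s)) * (C * L) := by
    calc ∑ k ∈ Sk, (rho k : ℝ) * h k
        ≤ ∑ k ∈ Sk, (x : ℝ) ^ (η * (1 - s)) * ((rho k : ℝ) / k) := by
          refine Finset.sum_le_sum fun k hk => ?_
          simp only [hSk, Finset.mem_filter, Finset.mem_Icc] at hk
          have hk0 : (0 : ℝ) < k := by exact_mod_cast hk.1.1
          have hkη : (k : ℝ) ^ (1 - s) ≤ (x : ℝ) ^ (η * (1 - s)) := by
            rw [Real.rpow_mul hx0.le]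
            exact Real.rpow_le_rpow hk0.le hk.2 (by linarith)
          simp only [hh]
          rw [show -s = (1 - s) - 1 by ring, Real.rpow_sub_one hk0.ne']
          calc (rho k : ℝ) * ((k : ℝ) ^ (1 - s) / k) = (k : ℝ) ^ (1 - s) * ((rho k : ℝ) / k) := by
                ring
            _ ≤ (x : ℝ) ^ (η * (1 - s)) * ((rho k : ℝ) / k) := by gcongr
      _ = (x : ℝ) ^ (η * (1 - s)) * ∑ k ∈ Sk, (rho k : ℝ) / k := by rw [Finset.mul_sum]
      _ ≤ (x : ℝ) ^ (η * (1 - s)) * (C * L) := by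
          refine mul_le_mul_of_nonneg_left ?_ (by positivity)
          calc ∑ k ∈ Sk, (rho k : ℝ) / k ≤ ∑ k ∈ Finset.Icc 1 x, (rho k : ℝ) / k :=
                Finset.sum_le_sum_of_subset_of_nonneg (fun k hk => by
                  simp only [hSk, Finset.mem_filter] at hk; exact hk.1) fun _ _ _ => by positivity
            _ ≤ C * L := sum_div_le_mul_one_add_log hC0 hC hx1
  have hT0 : 0 ≤ ∑ k ∈ Sk, (rho k : ℝ) * h k :=
    Finset.sum_nonneg fun k _ => by simp only [hh]; positivity
  refine (sum_sum_sum_sum_le_of_le_mul_add (g := G) (h := h) (B := B) (R := C * (x : ℝ) ^ η)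
    (N := 2 * (x : ℝ) ^ θ') hB0 (fun Q _ => by simp only [hG]; positivity)
    (fun k _ => by simp only [hh]; positivity) ?_ ?_ ?_ ?_ ?_ (by positivity)).trans ?_
  · -- the inner sums: the Burgess-type bound along the linear form
    intro Q hQ ν hν k hk a _
    simp only [hSQ, hSk, Finset.mem_filter, Finset.mem_range, Finset.mem_Icc] at hQ hν hk
    obtain ⟨hQx, hQp, hQθ, hQθ'⟩ := hQ
    have h2Q : 2 < Q := by exact_mod_cast hxθ.trans_lt hQθ
    have hkQ : k < Q := by exact_mod_cast (hk.2.trans hxηθ).trans_lt hQθ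
    have hβ : ¬ Q ∣ 2 * ν * k := not_dvd_two_mul_mul hQp h2Q hν.2 hk.1.1 hkQ
    have hQpos : (0 : ℝ) < Q := by exact_mod_cast hQp.pos
    have hk0 : (0 : ℝ) < k := by exact_mod_cast hk.1.1
    have hQx' : (Q : ℝ) ≤ x := by exact_mod_cast Nat.lt_succ_iff.1 hQx
    have hLQ : 1 + Real.log Q ≤ L := by rw [hL]; linarith [Real.log_le_log hQpos hQx']
    refine (abs_inner_le_of_intervalBound hQp hβ hk.1.1 hc hs0 (hB Q hQp (by omega))).trans ?_
    have hsub : ((x : ℝ) / ((Q : ℝ) * k) + 1) ^ s ≤ ((x : ℝ) / ((Q : ℝ) * k)) ^ s + 1 := by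
      have := Real.rpow_add_le_add_rpow
        (by positivity : (0 : ℝ) ≤ (x : ℝ) / ((Q : ℝ) * k)) zero_le_one hs0 hs1
      simpa only [Real.one_rpow] using this
    have e1 : ((x : ℝ) / ((Q : ℝ) * k)) ^ s * (Q : ℝ) ^ b =
        (x : ℝ) ^ s * (Q : ℝ) ^ (b - s) * (k : ℝ) ^ (-s) := by
      rw [Real.div_rpow hx0.le (by positivity), Real.mul_rpow hQpos.le hk0.le,
        Real.rpow_sub hQpos, Real.rpow_neg hk0.le]
      have hQs : (Q : ℝ) ^ s ≠ 0 := (Real.rpow_pos_of_pos hQpos s).ne'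
      have hks : (k : ℝ) ^ s ≠ 0 := (Real.rpow_pos_of_pos hk0 s).ne'
      field_simp
    have hQb : (Q : ℝ) ^ b ≤ (x : ℝ) ^ (θ' * b) := by
      rw [Real.rpow_mul hx0.le]
      exact Real.rpow_le_rpow hQpos.le hQθ' hb
    calc c * ((x : ℝ) / ((Q : ℝ) * k) + 1) ^ s * (Q : ℝ) ^ b * (1 + Real.log Q)
        ≤ c * (((x : ℝ) / ((Q : ℝ) * k)) ^ s + 1) * (Q : ℝ) ^ b * L := by gcongr
      _ = c * L * (((x : ℝ) / ((Q : ℝ) * k)) ^ s * (Q : ℝ) ^ b) + c * L * (Q : ℝ) ^ b := by ring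
      _ ≤ c * L * ((x : ℝ) ^ s * (Q : ℝ) ^ (b - s) * (k : ℝ) ^ (-s)) +
            c * L * (x : ℝ) ^ (θ' * b) := by rw [e1]; gcongr
      _ = G Q * h k + B := by simp only [hG, hh, hBdef]; ring
  · -- the root classes `a mod k`
    intro Q hQ ν _ k hk
    simp only [hSQ, hSk, Finset.mem_filter, Finset.mem_range, Finset.mem_Icc] at hQ hk
    obtain ⟨_, hQp, hQθ, _⟩ := hQ
    have hkQ : k < Q := by exact_mod_cast (hk.2.trans hxηθ).trans_lt hQθ
    have hcop : Q.Coprime k :=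
      (Nat.Prime.coprime_iff_not_dvd hQp).2 fun h => absurd (Nat.le_of_dvd (by omega) h) (by omega)
    exact_mod_cast card_filter_range_dvd_sq_add_one_le_rho hcop ν
  · -- `Σ_{k ≤ x^η} ρ(k) ≤ C x^η`
    have hfl : 1 ≤ ⌊(x : ℝ) ^ η⌋₊ :=
      Nat.le_floor (by exact_mod_cast Real.one_le_rpow hx1' hη.le)
    calc ∑ k ∈ Sk, (rho k : ℝ) ≤ ∑ k ∈ Finset.Icc 1 ⌊(x : ℝ) ^ η⌋₊, (rho k : ℝ) := by
          refine Finset.sum_le_sum_of_subset_of_nonneg (fun k hk => ?_) fun _ _ _ =>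
            Nat.cast_nonneg _
          simp only [hSk, Finset.mem_filter, Finset.mem_Icc] at hk ⊢
          exact ⟨hk.1.1, Nat.le_floor hk.2⟩
      _ ≤ C * (⌊(x : ℝ) ^ η⌋₊ : ℝ) := hC _ hfl
      _ ≤ C * (x : ℝ) ^ η := mul_le_mul_of_nonneg_left (Nat.floor_le (by positivity)) hC0
  · -- two roots `ν` per prime `Q`
    intro Q hQ
    simp only [hSQ, Finset.mem_filter, Finset.mem_range] at hQ
    exact_mod_cast rho_le_two hQ.2.1
  · -- the number of primes `Q ≤ x^{θ'}`
    have hsub : SQ ⊆ Finset.range (⌊(x : ℝ) ^ θ'⌋₊ + 1) := by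
      intro Q hQ
      simp only [hSQ, Finset.mem_filter, Finset.mem_range] at hQ ⊢
      exact Nat.lt_succ_of_le (Nat.le_floor hQ.2.2.2)
    calc (SQ.card : ℝ) ≤ ((Finset.range (⌊(x : ℝ) ^ θ'⌋₊ + 1)).card : ℝ) := by
          exact_mod_cast Finset.card_le_card hsub
      _ = (⌊(x : ℝ) ^ θ'⌋₊ : ℝ) + 1 := by rw [Finset.card_range]; push_cast; ring
      _ ≤ (x : ℝ) ^ θ' + 1 := by gcongr; exact Nat.floor_le (by positivity)
      _ ≤ 2 * (x : ℝ) ^ θ' := by have := Real.one_le_rpow hx1' hθ'0.le; linarith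
  · -- assembling: `2cC L³ x^{E₂} + 4cC L x^{E₁} ≤ 8cC x^E L³`
    have hP₂ : (x : ℝ) ^ s * (x : ℝ) ^ (θ' * (1 + b - s)) * (x : ℝ) ^ (η * (1 - s)) ≤
        (x : ℝ) ^ E := by
      rw [← Real.rpow_add hx0, ← Real.rpow_add hx0]
      exact Real.rpow_le_rpow_of_exponent_le hx1' (by linarith)
    have hP₁ : (x : ℝ) ^ θ' * (x : ℝ) ^ η * (x : ℝ) ^ (θ' * b) ≤ (x : ℝ) ^ E := by
      rw [← Real.rpow_add hx0, ← Real.rpow_add hx0]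
      exact Real.rpow_le_rpow_of_exponent_le hx1' (by linarith)
    have hLL : L ≤ L ^ 3 := by
      have h1 : 1 ≤ L * L := one_le_mul_of_one_le_of_one_le hL1 hL1
      calc L = L * 1 := (mul_one L).symm
        _ ≤ L * (L * L) := mul_le_mul_of_nonneg_left h1 hL0.le
        _ = L ^ 3 := by ring
    have h1 : (∑ Q ∈ SQ, G Q) * (2 * ∑ k ∈ Sk, (rho k : ℝ) * h k) ≤
        2 * c * C * ((x : ℝ) ^ E * L ^ 3) := by
      calc (∑ Q ∈ SQ, G Q) * (2 * ∑ k ∈ Sk, (rho k : ℝ) * h k)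
          ≤ (c * L * (x : ℝ) ^ s * ((x : ℝ) ^ (θ' * (1 + b - s)) * L)) *
              (2 * ((x : ℝ) ^ (η * (1 - s)) * (C * L))) :=
            mul_le_mul hGsum (mul_le_mul_of_nonneg_left hhsum zero_le_two)
              (mul_nonneg zero_le_two hT0) (by positivity)
        _ = 2 * c * C * (((x : ℝ) ^ s * (x : ℝ) ^ (θ' * (1 + b - s)) *
              (x : ℝ) ^ (η * (1 - s))) * L ^ 3) := by ring
        _ ≤ 2 * c * C * ((x : ℝ) ^ E * L ^ 3) := by gcongr
    have h2 : 2 * (x : ℝ) ^ θ' * (2 * (C * (x : ℝ) ^ η * B)) ≤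
        4 * c * C * ((x : ℝ) ^ E * L ^ 3) := by
      calc 2 * (x : ℝ) ^ θ' * (2 * (C * (x : ℝ) ^ η * B))
          = 4 * c * C * (((x : ℝ) ^ θ' * (x : ℝ) ^ η * (x : ℝ) ^ (θ' * b)) * L) := by
            simp only [hBdef]; ring
        _ ≤ 4 * c * C * ((x : ℝ) ^ E * L ^ 3) := by gcongr
    have h0 : 0 ≤ c * C * ((x : ℝ) ^ E * L ^ 3) := by positivity
    linarith

/-! ### The theorem: `PureDigitPiecesPow` in the Burgess range, conditionally -/

/-- **The pure digit pieces have a power saving in the Burgess range, conditionally on Burgess's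
bound.** Assume Burgess's estimate for the Legendre symbol (Iwaniec–Kowalski Thm 12.6, Burgess
1963; in print, not in the tree, hence an explicit hypothesis): for every integer `r ≥ 1` there is
`c > 0` with `|Σ_{M < n ≤ M+N} (n | p)| ≤ c N^{1−1/r} p^{(r+1)/(4r²)} (1 + log p)` for all odd
primes `p` and all `M, N`.  Then for `1/2 < θ < θ′ < 1`, `0 < η` and `θ′/4 < 1 − θ′ − η` (the
Burgess range) there is `δ > 0` with
`Σ_{x^θ<Q≤x^{θ′} prime} Σ_{ν²≡−1 (Q), ν<Q} Σ_{1≤k≤x^η} Σ_{a<k, Qk ∣ (ν+Qa)²+1}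
   |Σ_{u ≤ x : ν + Q(a+ku) ≤ x} ((ν²+1)/Q + 2ν(a+ku) | Q)| = O(x^{1−δ})`.
Proof: fix `r ≥ 2` with `θ′(r+1)/(4r) < 1 − θ′ − η` (possible as `(r+1)/(4r) → 1/4`); with
`s = 1 − 1/r`, `b = (r+1)/(4r²)` the majorant `burgess_sum_le_majorant` is
`O(x^E (1 + log x)³)` for `E = max(θ′ + η + θ′b, 1 − (1 − θ′ − η)/r + θ′b) < 1`, and
`x^E (1 + log x)³ = O(x^{E + (1−E)/2}) = O(x^{1−δ})` with `δ = (1 − E)/2`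
(`rpow_mul_one_add_log_pow_three_isBigO`).  This is the literal statement of
`stub_pureDigitPiecesPow` in the Burgess range under the explicit Burgess hypothesis; beyond the
Burgess range the statement is open. [folklore] -/
theorem pureDigitPiecesPow_of_burgess_range :
    (∀ r : ℕ, 1 ≤ r → ∃ c : ℝ, 0 < c ∧ ∀ p : ℕ, p.Prime → p ≠ 2 → ∀ M N : ℕ,
      |∑ n ∈ Finset.Ioc M (M + N), (jacobiSym (n : ℤ) p : ℝ)| ≤
        c * (N : ℝ) ^ (1 - 1 / (r : ℝ)) * (p : ℝ) ^ (((r : ℝ) + 1) / (4 * (r : ℝ) ^ 2)) *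
          (1 + Real.log p)) →
    ∀ θ θ' η : ℝ, 1 / 2 < θ → θ < θ' → θ' < 1 → 0 < η → θ' / 4 < 1 - θ' - η →
      ∃ δ : ℝ, 0 < δ ∧
        (fun x : ℕ =>
          ∑ Q ∈ (Finset.range (x + 1)).filter
              (fun Q : ℕ => Q.Prime ∧ (x : ℝ) ^ θ < (Q : ℝ) ∧ (Q : ℝ) ≤ (x : ℝ) ^ θ'),
            ∑ ν ∈ (Finset.range Q).filter (fun ν : ℕ => Q ∣ ν ^ 2 + 1),
              ∑ k ∈ (Finset.Icc 1 x).filter (fun k : ℕ => (k : ℝ) ≤ (x : ℝ) ^ η),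
                ∑ a ∈ (Finset.range k).filter (fun a : ℕ => Q * k ∣ (ν + Q * a) ^ 2 + 1),
                  |∑ u ∈ (Finset.range (x + 1)).filter (fun u : ℕ => ν + Q * (a + k * u) ≤ x),
                      (jacobiSym (((ν ^ 2 + 1) / Q + 2 * ν * (a + k * u) : ℕ) : ℤ) Q : ℝ)|)
          =O[Filter.atTop] fun x : ℕ => (x : ℝ) ^ (1 - δ) := by
  intro hB θ θ' η hθ hθθ' hθ'1 hη hr
  -- the choice of `r`: `θ'(r+1)/(4r) < 1 - θ' - η`
  set ε₀ : ℝ := 1 - θ' - η - θ' / 4 with hε₀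
  have hε₀0 : 0 < ε₀ := by rw [hε₀]; linarith
  have hθ'0 : 0 < θ' := by linarith
  set r : ℕ := ⌈θ' / (4 * ε₀)⌉₊ + 2 with hr_def
  have hr2 : 2 ≤ r := by omega
  have hR2 : (2 : ℝ) ≤ r := by exact_mod_cast hr2
  have hRpos : (0 : ℝ) < r := by linarith
  have hRgt : θ' / (4 * ε₀) < r := by
    have h1 : θ' / (4 * ε₀) ≤ ⌈θ' / (4 * ε₀)⌉₊ := Nat.le_ceil _
    have h2 : (⌈θ' / (4 * ε₀)⌉₊ : ℝ) + 2 = r := by rw [hr_def]; push_cast; ring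
    linarith
  have hkey : θ' * ((r : ℝ) + 1) / (4 * r) < 1 - θ' - η := by
    have h1 : θ' / (4 * r) < ε₀ := by
      rw [div_lt_iff₀ (by positivity)]
      rw [div_lt_iff₀ (by positivity)] at hRgt
      linarith
    have h2 : θ' * ((r : ℝ) + 1) / (4 * r) = θ' / 4 + θ' / (4 * r) := by
      field_simp
    rw [h2]
    linarith
  obtain ⟨c, hc0, hcB⟩ := hB r (by omega)
  obtain ⟨C, hC0, hC⟩ := exists_sum_rho_le_nat
  set s : ℝ := 1 - 1 / (r : ℝ) with hs
  set b : ℝ := ((r : ℝ) + 1) / (4 * (r : ℝ) ^ 2) with hb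
  have hb0 : 0 ≤ b := by positivity
  have hs0 : 0 ≤ s := by
    rw [hs, sub_nonneg, div_le_one hRpos]; linarith
  have hs1 : s ≤ 1 := by
    rw [hs]; linarith [div_nonneg zero_le_one hRpos.le]
  have hbR : θ' * b * r = θ' * ((r : ℝ) + 1) / (4 * r) := by
    simp only [hb]; field_simp
  have hbR' : θ' * b * r < 1 - θ' - η := hbR ▸ hkey
  set E₁ : ℝ := θ' + η + θ' * b with hE₁
  set E₂ : ℝ := s + θ' * (1 + b - s) + η * (1 - s) with hE₂
  have hE₁1 : E₁ < 1 := by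
    have : θ' * b ≤ θ' * b * r := le_mul_of_one_le_right (by positivity) (by linarith)
    rw [hE₁]; linarith
  have hE₂1 : E₂ < 1 := by
    have h1 : (r : ℝ) * (E₂ - 1) = θ' * b * r - (1 - θ' - η) := by
      simp only [hE₂, hs]; field_simp; ring
    have h2 : (r : ℝ) * (E₂ - 1) < 0 := by rw [h1]; linarith
    refine not_le.1 fun h3 => ?_
    exact absurd h2 (not_lt.2 (mul_nonneg hRpos.le (by linarith)))
  set E : ℝ := max E₁ E₂ with hE
  have hE1 : E < 1 := max_lt hE₁1 hE₂1
  refine ⟨(1 - E) / 2, by linarith, ?_⟩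
  have hmaj := burgess_sum_le_majorant (θ := θ) (θ' := θ') (η := η) (E := E) (by linarith) hθ'0
    hη (by linarith) hC0.le hC hc0.le hs0 hs1 hb0 (le_max_left _ _) (le_max_right _ _) hcB
  have h1 : (fun x : ℕ =>
      ∑ Q ∈ (Finset.range (x + 1)).filter
          (fun Q : ℕ => Q.Prime ∧ (x : ℝ) ^ θ < (Q : ℝ) ∧ (Q : ℝ) ≤ (x : ℝ) ^ θ'),
        ∑ ν ∈ (Finset.range Q).filter (fun ν : ℕ => Q ∣ ν ^ 2 + 1),
          ∑ k ∈ (Finset.Icc 1 x).filter (fun k : ℕ => (k : ℝ) ≤ (x : ℝ) ^ η),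
            ∑ a ∈ (Finset.range k).filter (fun a : ℕ => Q * k ∣ (ν + Q * a) ^ 2 + 1),
              |∑ u ∈ (Finset.range (x + 1)).filter (fun u : ℕ => ν + Q * (a + k * u) ≤ x),
                  (jacobiSym (((ν ^ 2 + 1) / Q + 2 * ν * (a + k * u) : ℕ) : ℤ) Q : ℝ)|)
      =O[Filter.atTop] fun x : ℕ => (x : ℝ) ^ E * (1 + Real.log x) ^ 3 := by
    refine IsBigO.of_bound (8 * c * C) ?_
    filter_upwards [hmaj] with x hx
    rw [Real.norm_eq_abs, Real.norm_eq_abs, abs_of_nonneg (by positivity)]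
    exact hx.trans (mul_le_mul_of_nonneg_left (le_abs_self _) (by positivity))
  refine h1.trans ?_
  have h2 := rpow_mul_one_add_log_pow_three_isBigO (s := E) (ε := (1 - E) / 2) (by linarith)
  rw [show 1 - (1 - E) / 2 = E + (1 - E) / 2 by ring]
  exact h2

end Summit.Parity.BatemanHorn.Cruxes.SplitBlockJacobi.SplitMassMiddlePrime

end
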